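import Mathlib
import HarnessLib
import Literature.Geometry.Lorentzian.PseudoRiemannianMetric
import Literature.Geometry.Lorentzian.LeviCivita
import Literature.Geometry.Lorentzian.Isometry

/-!
# Circle actions with a codimension-two fixed component carry invariant metrics of positive scalar curvature (Wiemeler 2016) — the 4-dimensional case

## What is printed

M. Wiemeler, *Circle actions and scalar curvature*, Trans. Amer. Math. Soc. 368 (2016) 2939–2966
(doi:10.1090/tran/6666, arXiv:1305.2288), Theorem 1.1, p. 3 of the arXiv text, read at page level
(`lit read arxiv:1305.2288`, 2026-08-17), verbatim:

> "Let G be a compact Lie-group. Assume that there is a circle subgroup S¹ ⊂ Z(G) contained in the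
> center of G. Moreover, let M be a closed connected effective G-manifold such that there is a
> component F of M^{S¹} with codim F = 2. Then there is an G-invariant metric of positive scalar
> curvature on M."

(p. 2: "there exist S¹-invariant metrics of positive scalar curvature on every S¹-manifold which has
a fixed point component of codimension 2"; no restriction on dim M.)

## How it is rendered here (D-0014)

The SPECIALISATION `G = S¹`, `dim M = 4` used by route `SmoothPoincare4/ChargedHalfTurns`: `M` a
closed (compact, boundaryless `IsManifold (𝓡 4) ⊤`) connected smooth 4-manifold with an effective
(`FaithfulSMul`) smooth (`ContMDiffSMul`) action of `Circle`, whose fixed-point set contains a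
smoothly embedded 2-sphere fixed pointwise — the fixed component containing that sphere is then a
closed submanifold of dimension ≥ 2 and even codimension, i.e. of codimension exactly 2, so
Theorem 1.1 applies — and the conclusion "an S¹-invariant Riemannian metric of positive scalar
curvature" written with the tree's `Literature.Geometry.Lorentzian.PseudoRiemannianMetric`
(Levi-Civita connection, `IsRiemannian`, `scalarCurvature`, invariance as equality of the pulled-back
bilinear form `pullbackBilin`). This is VERBATIM the route item
`Summit.SmoothPoincare4.SmoothPoincare4.Theses.ChargedHalfTurns.CircleRung` (stmt-SmoothPoincare4-18213),
which it grounds; the item is this fact (definitionally). Users take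
`(h : wiemeler2016_circle_codimTwo_psc_dim4)`.
-/

open scoped Manifold ContDiff Topology

namespace Literature.Geometry.Riemannian

/-- **Wiemeler 2016, Theorem 1.1 (G = S¹, dimension 4; named fact).** A closed connected smooth
4-manifold with an effective smooth circle action fixing pointwise a smoothly embedded 2-sphere
carries an `S¹`-invariant Riemannian metric of positive scalar curvature. Specialisation of the
printed theorem (any compact Lie group `G` with a central circle, any dimension, a fixed component of
codimension two) — see the module docstring for the verbatim statement and why the hypotheses here
imply Wiemeler's. Grounds `Summit.SmoothPoincare4.SmoothPoincare4.Theses.ChargedHalfTurns.CircleRung`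
(stmt-SmoothPoincare4-18213), verbatim. [cite: Wiemeler2013, Thm. 1.1 (p. 3)] -/
def wiemeler2016_circle_codimTwo_psc_dim4 : Prop :=
  ∀ (M : Type) [TopologicalSpace M] [T2Space M] [SecondCountableTopology M] [ChartedSpace (EuclideanSpace ℝ (Fin 4)) M] [IsManifold (𝓡 4) ((⊤ : ℕ∞) : WithTop ℕ∞) M] [CompactSpace M] [ConnectedSpace M] [MulAction Circle M], FaithfulSMul Circle M → ContMDiffSMul (𝓡 1) (𝓡 4) ((⊤ : ℕ∞) : WithTop ℕ∞) Circle M → (∃ e : Metric.sphere (0 : EuclideanSpace ℝ (Fin 3)) 1 → M, Manifold.IsSmoothEmbedding (𝓡 2) (𝓡 4) ((⊤ : ℕ∞) : WithTop ℕ∞) e ∧ ∀ x ∈ Set.range e, ∀ z : Circle, z • x = x) → ∃ (g : Literature.Geometry.Lorentzian.PseudoRiemannianMetric (𝓡 4) ((⊤ : ℕ∞) : WithTop ℕ∞) (EuclideanSpace ℝ (Fin 4)) (TangentSpace (𝓡 4) : M → Type _)) (_ : g.HasLeviCivita), g.IsRiemannian ∧ (∀ x, 0 < g.scalarCurvature x)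 ∧ ∀ (z : Circle) (y : M), Literature.Geometry.Lorentzian.pullbackBilin (I := 𝓡 4) (I' := 𝓡 4) (fun x : M => z • x) g.val y = g.val y

end Literature.Geometry.Riemannian
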